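import Summits.QuantumFields.YangMills.Theorems.UnitScaleTiltHalvingP1FlatCoreSupplierInduction
import Literature.MathematicalPhysics.QuantumFieldTheory.Balaban1983to89.B8Thm4AtLandau138G
import Literature.MathematicalPhysics.QuantumFieldTheory.Balaban1983to89.B8Prop6OfThm4
import Literature.MathematicalPhysics.QuantumFieldTheory.Balaban1983to89.B8Ineq133CubeMemberGamma
import Literature.MathematicalPhysics.QuantumFieldTheory.Balaban1983to89.B8CubeMemberZd
import HarnessLib

/-!
# «H = hSupUρ2 ⟸ hSiteRows» (LEAD-H BOARD v3), row (τ-D) [τ-DATUM]: THE J3 → THEOREM-4 JUNCTION CALL WITH `G`-VALUED GAUGE TRANSFORMATIONS — ✓p647600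
# `HalvingP1FlatCoreSupplierInduction.datum_of_preGauge(_cubeMember)` re-run over the `G`-valued driver lit ✓`B8Thm4AtLandau138G.thm4_exists_all_levels_landau138_mem`,
# so that Theorem 4's lower gauge `u₁` is delivered IN `G` (at `G := specialUnitaryUnits (Fin 2)`: the displayed τ-datum row `hu₁SU` of ✓p647313 ∕ ✓p650940)

Route `UnitScaleTilt`, crux K1 child «MinimiserStabilityRegPr» (stmt-QuantumFields-19200), registered stub `stub_halvingStep` (`BirthV10`).  Cell `ym3-torus` (rung R3, NOT Clay),
width seat `ym-ust-19200-w3` (gen 7).  `--supports stmt-QuantumFields-19200 --as helper`; THEOREMS ONLY (0 `def`, 0 `sorry`); count-neutral.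

WHY.  The per-site text `hSiteRows` displays `hu₁SU : ∀ z, ↑(u₁ z) ∈ SU(2)` next to Theorem 4's datum `(u₁, W, A)`; the unitary driver cannot emit it.  With the Proposition-5 sockets
in `G`-form — their τ-bodies lit ✓`B8SockHFPTraceFree.sockHFP(₀)_body_of_join_RD_traceFree` give `τ(λ) = 0`, whence `v = e^{iλ} ∈ SU(N)` (lit ✓`B8SpecialUnitaryTrace`) — the induction's
`u = ∏ v` stays in `G`, and the junction call delivers the datum block AND `u₁ ∈ G` from the same displayed sockets.

WHAT IS PROVED (sorry-free, no definition): §1 ★★ `datum_of_preGauge_mem` (generic `Ω`) and ★★★ `datum_of_preGauge_cubeMember_mem` (N05's cube member, `hΩ`∕`hΩbox` discharged as in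
✓p647600) — sockets `hP5base hP5` in `G`-form, `H42 H59` and the windows VERBATIM, J3's rows `hInAk`∕`hfine` as before, conclusion = ✓p647600's PLUS `∀ x, u₁ x ∈ G`; §2 `hu₁SU_of_mem`;
§3 ★★★ `datum_of_preGauge_cubeMember_SU` — the `𝔸 := M₂(ℂ)`, `G := specialUnitaryUnits (Fin 2)` edition with the conclusion's `u₁`-row in ✓p647313's letter `∀ z, ↑(u₁ z) ∈ Matrix.specialUnitaryGroup (Fin 2) ℂ`
(`letI := B10Eq29TubeLine.cstarAlgebraMatrix 2` inside the proof only).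
HONEST SCOPE: by-name bookkeeping; Theorem 4 ∕ Proposition 5 ∕ [4] NOT proved (sockets displayed).  Rung R3 (YM₃ on T³), NOT Clay; YM gap NOT proved.

References: T. Bałaban, CMP **99** (1985) 75–102 [Balaban1985RegularSpaces] (Thm 4 p.88, Prop. 5 p.94, (1.66) p.87, p.76, p.98); CMP **96** (1984) 223–250
[Balaban1985BackgroundPropagators] (Thm 3.3 p.398).
-/

set_option autoImplicit false

noncomputable section

namespace Summit.QuantumFields.YangMills.Theorems.HalvingP1FlatCoreSupplierInductionSU

open Literature.MathematicalPhysics.QuantumFieldTheory.Balaban1983to89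
open MatrixLog B7Prop1Explicit B7Prop2Explicit B7Prop1Local B7Eq92Concrete
open B8Lemma1NonAbelian (mulCfg)
open B8Ineq132 (covDerivFwd InAk BondTouches)
open B8Eq140Level (SideTouches sideTouches_of_bondTouches)
open B8Eq184Proof (gaugeExp cfgExp)
open B8Eq146AExpansion (iEta)
open B7Prop4GeneralLevels (logCovIter linCovIter)
open B8Eq155JBound (Jcur wsup)
open B8ScaledSupNorm (bondNorm msup)
open B7Prop3Flat (c3)
open B8Eq138LandauZd (IsLandau138W logCfg)
open B8Ineq130 (tlo thi)
open B8Eq119TwistedAxial (Restr129 InAx)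
open B8Thm4AtLandau138G (thm4_exists_all_levels_landau138_mem)
open B8Prop6OfThm4 (one_inAk)
open B8Eq131Cubes (tLo tHi collar_cube)
open B8Eq131CubesAdmissible (cubeFam cubeFam_false_of_le)
open B8CubeMemberZd (hΩ_cubeFam)
open Summit.QuantumFields.YangMills.Theorems.P1FlatCorePreGauge (inAk_of_univ)
open HalvingP1FlatCoreSupplierInduction (mulCfg_one_right ends_of_sideTouches)

-- `Site` alone could resolve to the torus sites of `Setup.lean`; use the `ℤ^d` sites of `B7Prop1Explicit`.
open B7Prop1Explicit (Site)

variable {d : ℕ}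

section Main

variable {𝔸 : Type*} [CStarAlgebra 𝔸] [Nontrivial 𝔸]

/-! ## §1 The junction call with `G`-valued gauge transformations -/

/-- ★★ **THE JUNCTION CALL WITH `G`-VALUED GAUGE TRANSFORMATIONS** — ✓`datum_of_preGauge` over the `G`-valued driver
lit ✓`B8Thm4AtLandau138G.thm4_exists_all_levels_landau138_mem`: sockets `hP5base`∕`hP5` in `G`-form (`v`, `u₁` `G`-valued), conclusion `∀ x, u₁ x ∈ G`;
everything else VERBATIM. [cite: Balaban1985RegularSpaces, Thm 4 p.88, Prop. 5 p.94, p.76 («G = SU(N)»)] -/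
theorem datum_of_preGauge_mem (hd2 : 2 ≤ d) {η : ℝ} (hη : 0 < η) {L : ℕ} (hL : 2 ≤ L) (k : ℕ) (G : Subgroup 𝔸ˣ) (hG : G ≤ unitaryUnits 𝔸)
    {U' : Site d → Fin d → 𝔸ˣ} (hU' : ∀ x κ, U' x κ ∈ unitaryUnits 𝔸)
    {α₀ α₁ α₄ B₀ cstar a : ℝ} (hα₀ : 0 < α₀) (hα₁ : 0 ≤ α₁) (hα₄ : 0 ≤ α₄) (hB₀ : 0 ≤ B₀)
    (hc : cstar = 5 * d * L * B₀ * (α₀ + α₁))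
    (hs₁ : α₄ ≤ 1 / 84) (hs₂ : L * cstar ≤ 1 / 12) (ha : a ≤ 1 / 4) (ha2 : 2 * a ≤ cstar)
    (hα3 : C0 d * α₀ ≤ 1 / 3) (hα4 : 4 * α₀ ≤ c2' d L)
    (h16 : 16 * (2 * (L * cstar) + 8 * α₄) ≤ 1) (hd5 : 5 * (2 * (L * cstar) + 8 * α₄) * ((d : ℝ) - 1) ≤ 4)
    (hsmall : Real.exp (4 * (800 * ((d : ℝ) + 1) ^ 2 * ((d : ℝ) + 4)) * α₀)
      * (1 + 8 * (131072 * ((d : ℝ) + 1) ^ 2) * (2 * (L * cstar) + 8 * α₄)) ≤ 2)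
    (hc₃ : 2 * (2 * (L * cstar) + 8 * α₄) ≤ c3 d L) (hside : 36 * d * B₀ * (2 * (L * cstar) + 8 * α₄) ≤ 1 / 2)
    (h50 : 50 * d * (2 * (L * cstar) + 8 * α₄) ≤ 1)
    {C₂ : ℝ} (hC₂ : 8 * (131072 * ((d : ℝ) + 1) ^ 2) * Real.exp (4 * (800 * ((d : ℝ) + 1) ^ 2 * ((d : ℝ) + 4)) * α₀) ≤ C₂)
    (h61 : 2 * (2 * (L * cstar) + 8 * α₄) ^ 2 + 20 * d * α₀ * (2 * (L * cstar) + 8 * α₄)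
      + 2 * C₂ * (2 * (L * cstar) + 8 * α₄) ^ 2 ≤ α₀ + α₁)
    (Ω : ℕ → Set (Site d)) (hΩ : ∀ j, Ω (j + 1) ⊆ Ω j) (Λs : ℕ → ℕ → Set (Site d)) (Λb : ℕ → ℕ → Set (Site d × Fin d))
    (hbox : ∀ m, m ≤ k → ∀ j, j ≤ m → ∀ c ∈ Λb m j, ∀ x, InBox (loK L j c.1) (bondHiK L j c.1 c.2) x → x ∈ Ω j)
    -- THE PRE-GAUGED FIELD's ROWS IN J3's LETTERS: (1.34)-𝔄 on all of `ℤᵈ` (✓`exists_preGauge_flat` (a)) and the fine near-`1` on the blow-up of the top box (its (d) at depth `k`)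
    (hInAk : InAk L k η α₀ (fun _ => (Set.univ : Set (Site d))) U')
    {lo hi : Site d} (hΩbox : ∀ (y : Site d) (τ : Fin d), SideTouches (Ω 0) y τ → tlo L lo k ≤ y ∧ y + e τ ≤ thi L hi k)
    (hfine : ∀ (x : Site d) (ν : Fin d), tlo L lo k ≤ x → x + e ν ≤ thi L hi k → ‖((U' x ν : 𝔸ˣ) : 𝔸) - 1‖ < a)
    (hP5base : ∃ (v : Site d → 𝔸ˣ) (lam : Site d → 𝔸), (∀ x, v x ∈ G) ∧
        (∀ j, j ≤ 1 → ∀ b ∈ {b : Site d × Fin d | SideTouches (Ω j) b.1 b.2}, (v b.1 : 𝔸) = ((gaugeExp lam b.1 : 𝔸ˣ) : 𝔸) ∧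
          (v (b.1 + e b.2) : 𝔸) = ((gaugeExp lam (b.1 + e b.2) : 𝔸ˣ) : 𝔸)) ∧
        (∀ j, j ≤ 1 → ∀ b ∈ {b : Site d × Fin d | SideTouches (Ω j) b.1 b.2},
          ‖lam b.1‖ ≤ α₄ ∧ ((L : ℝ) ^ j * η) * ‖covDerivFwd η (1 : Site d → Fin d → 𝔸ˣ) b.2 lam b.1‖ ≤ α₄) ∧
        IsLandau138W L 1 η (Ω 0) (Λs 1) (1 : Site d → Fin d → 𝔸ˣ) (mgauge (1 : Site d → Fin d → 𝔸ˣ) v⁻¹ U') ∧ Restr129 L 1 (Λs 1) (1 : Site d → Fin d → 𝔸ˣ) ((1 : Site d → 𝔸ˣ) * v))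
    (hP5 : ∀ m, 1 ≤ m → m < k → ∀ (u₁ : Site d → 𝔸ˣ) (U₁ : Site d → Fin d → 𝔸ˣ) (A : Site d → Fin d → 𝔸),
      (∀ x, u₁ x ∈ G) → mgauge (1 : Site d → Fin d → 𝔸ˣ) u₁ U₁ = U' → Restr129 L m (Λs m) (1 : Site d → Fin d → 𝔸ˣ) u₁ → IsLandau138W L m η (Ω 0) (Λs m) (1 : Site d → Fin d → 𝔸ˣ) U₁ →
      (∀ j, j ≤ m → ∀ b ∈ {b : Site d × Fin d | SideTouches (Ω j) b.1 b.2},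
        U₁ b.1 b.2 = cfgExp η A b.1 b.2 ∧ IsSelfAdjoint (A b.1 b.2) ∧ ‖A b.1 b.2‖ ≤ cstar * ((L : ℝ) ^ j * η)⁻¹) →
      ∃ (v : Site d → 𝔸ˣ) (lam : Site d → 𝔸), (∀ x, v x ∈ G) ∧
        (∀ j, j ≤ m + 1 → ∀ b ∈ {b : Site d × Fin d | SideTouches (Ω j) b.1 b.2}, (v b.1 : 𝔸) = ((gaugeExp lam b.1 : 𝔸ˣ) : 𝔸) ∧
          (v (b.1 + e b.2) : 𝔸) = ((gaugeExp lam (b.1 + e b.2) : 𝔸ˣ) : 𝔸)) ∧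
        (∀ j, j ≤ m + 1 → ∀ b ∈ {b : Site d × Fin d | SideTouches (Ω j) b.1 b.2},
          ‖lam b.1‖ ≤ α₄ ∧ ((L : ℝ) ^ j * η) * ‖covDerivFwd η (1 : Site d → Fin d → 𝔸ˣ) b.2 lam b.1‖ ≤ α₄) ∧
        IsLandau138W L (m + 1) η (Ω 0) (Λs (m + 1)) (1 : Site d → Fin d → 𝔸ˣ) (mgauge (1 : Site d → Fin d → 𝔸ˣ) v⁻¹ U₁) ∧ Restr129 L (m + 1) (Λs (m + 1)) (1 : Site d → Fin d → 𝔸ˣ) (u₁ * v))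
    (H42 : ∀ m, 1 ≤ m → m ≤ k → ∀ (u : Site d → 𝔸ˣ) (W : Site d → Fin d → 𝔸ˣ) (A' : Site d → Fin d → 𝔸),
      (∀ x, u x ∈ unitaryUnits 𝔸) → mgauge (1 : Site d → Fin d → 𝔸ˣ) u W = U' → Restr129 L m (Λs m) (1 : Site d → Fin d → 𝔸ˣ) u → IsLandau138W L m η (Ω 0) (Λs m) (1 : Site d → Fin d → 𝔸ˣ) W →
      (∀ y τ, IsSelfAdjoint (A' y τ)) →
      (∀ j, j ≤ m → ∀ y τ, SideTouches (Ω j) y τ →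
        W y τ = cfgExp η A' y τ ∧ ‖A' y τ‖ ≤ (2 * (L * cstar) + 8 * α₄) * ((L : ℝ) ^ j * η)⁻¹) →
      (∀ y τ, (∀ j, j ≤ m → ¬ SideTouches (Ω j) y τ) → A' y τ = 0) →
      ∀ j, j ≤ m → ∀ c ∈ Λb m j, ‖logCovIter L (1 : Site d → Fin d → 𝔸ˣ) (iEta η A') j c.1 c.2‖ < 2 * d * L * α₁)
    (H59 : ∀ m, 1 ≤ m → m ≤ k → ∀ (u : Site d → 𝔸ˣ) (W : Site d → Fin d → 𝔸ˣ) (A' : Site d → Fin d → 𝔸),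
      (∀ x, u x ∈ unitaryUnits 𝔸) → mgauge (1 : Site d → Fin d → 𝔸ˣ) u W = U' → Restr129 L m (Λs m) (1 : Site d → Fin d → 𝔸ˣ) u → IsLandau138W L m η (Ω 0) (Λs m) (1 : Site d → Fin d → 𝔸ˣ) W →
      (∀ y τ, IsSelfAdjoint (A' y τ)) →
      (∀ j, j ≤ m → ∀ y τ, SideTouches (Ω j) y τ →
        W y τ = cfgExp η A' y τ ∧ ‖A' y τ‖ ≤ (2 * (L * cstar) + 8 * α₄) * ((L : ℝ) ^ j * η)⁻¹) →
      (∀ y τ, (∀ j, j ≤ m → ¬ SideTouches (Ω j) y τ) → A' y τ = 0) →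
      msup L m η (-(1 : ℝ)) (fun j (b : Site d × Fin d) => SideTouches (Ω j) b.1 b.2) (fun b => A' b.1 b.2)
          ≤ B₀ * (bondNorm L m η (-(3 : ℝ)) Ω (fun x μ => Jcur η (1 : Site d → Fin d → 𝔸ˣ) A' μ x)
            + wsup 1 (fun p : {p : ℕ × (Site d × Fin d) // p.1 ≤ m ∧ p.2 ∈ Λb m p.1} =>
                linCovIter L (1 : Site d → Fin d → 𝔸ˣ) (iEta η A') p.1.1 p.1.2.1 p.1.2.2)) ∧
        msup L m η (-(2 : ℝ)) (fun j (t : Fin d × Fin d × Site d) => SideTouches (Ω j) t.2.2 t.2.1)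
            (fun t => covDerivFwd η (1 : Site d → Fin d → 𝔸ˣ) t.1 (fun z => A' z t.2.1) t.2.2)
          ≤ B₀ * (bondNorm L m η (-(3 : ℝ)) Ω (fun x μ => Jcur η (1 : Site d → Fin d → 𝔸ˣ) A' μ x)
            + wsup 1 (fun p : {p : ℕ × (Site d × Fin d) // p.1 ≤ m ∧ p.2 ∈ Λb m p.1} =>
                linCovIter L (1 : Site d → Fin d → 𝔸ˣ) (iEta η A') p.1.1 p.1.2.1 p.1.2.2))) :
    ∀ m, m ≤ k → ∃ u : Site d → 𝔸ˣ, (∀ x, u x ∈ G) ∧ Restr129 L m (Λs m) (1 : Site d → Fin d → 𝔸ˣ) u ∧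
      ∃ W : Site d → Fin d → 𝔸ˣ, mgauge (1 : Site d → Fin d → 𝔸ˣ) u W = U' ∧ (1 ≤ m → IsLandau138W L m η (Ω 0) (Λs m) (1 : Site d → Fin d → 𝔸ˣ) W) ∧
        ∃ A : Site d → Fin d → 𝔸, ∀ j, j ≤ m → ∀ b ∈ {b : Site d × Fin d | SideTouches (Ω j) b.1 b.2},
          W b.1 b.2 = cfgExp η A b.1 b.2 ∧ IsSelfAdjoint (A b.1 b.2) ∧ ‖A b.1 b.2‖ ≤ cstar * ((L : ℝ) ^ j * η)⁻¹ := by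
  have hL1 : 1 ≤ L := le_trans (by norm_num) hL
  have hU₀ : ∀ (x : Site d) (κ : Fin d), (1 : Site d → Fin d → 𝔸ˣ) x κ ∈ unitaryUnits 𝔸 := fun _ _ => one_mem _
  have h33 : InAk L k η α₀ Ω (1 : Site d → Fin d → 𝔸ˣ) := one_inAk hL1 k hη hα₀ Ω
  have h34 : InAk L k η α₀ Ω (mulCfg U' (1 : Site d → Fin d → 𝔸ˣ)) := by
    rw [mulCfg_one_right]; exact inAk_of_univ hInAk Ω
  have h66 : ∀ b ∈ {b : Site d × Fin d | SideTouches (Ω 0) b.1 b.2}, ‖((U' b.1 b.2 : 𝔸ˣ) : 𝔸) - 1‖ ≤ a := by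
    rintro ⟨y, τ⟩ hb
    obtain ⟨h1, h2⟩ := hΩbox y τ hb
    exact (hfine y τ h1 h2).le
  exact thm4_exists_all_levels_landau138_mem hd2 hη hL k G hG hU₀ hU' hα₀ hα₁ hα₄ hB₀ hc hs₁ hs₂ ha ha2 hα3 hα4 h16 hd5 hsmall hc₃
    hside h50 hC₂ h61 Ω hΩ Λs Λb hbox h33 h34 h66 hP5base hP5 H42 H59

/-- ★★★ **THE JUNCTION CALL AT N05's CUBE MEMBER WITH `G`-VALUED GAUGE TRANSFORMATIONS** — ✓`datum_of_preGauge_cubeMember` over the `G`-valued driver: at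
`G := B7Prop2SpecialUnitary.specialUnitaryUnits (Fin 2)` its extra conjunct `∀ x, u₁ x ∈ G` is the τ-datum row `hu₁SU` of ✓`HalvingP1FlatCoreSupplierAssembly.hSupBlock_of_topRows`
∕ «H = hSupUρ2 ⟸ hSiteRows» (`hu₁SU_of_mem` below). [cite: Balaban1985RegularSpaces, Thm 4 p.88, p.98, (1.66) p.87, p.76] -/
theorem datum_of_preGauge_cubeMember_mem (hd2 : 2 ≤ d) {η : ℝ} (hη : 0 < η) {L : ℕ} (hL : 2 ≤ L) (k : ℕ) (G : Subgroup 𝔸ˣ) (hG : G ≤ unitaryUnits 𝔸)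
    {U' : Site d → Fin d → 𝔸ˣ} (hU' : ∀ x κ, U' x κ ∈ unitaryUnits 𝔸)
    {α₀ α₁ α₄ B₀ cstar a : ℝ} (hα₀ : 0 < α₀) (hα₁ : 0 ≤ α₁) (hα₄ : 0 ≤ α₄) (hB₀ : 0 ≤ B₀)
    (hc : cstar = 5 * d * L * B₀ * (α₀ + α₁))
    (hs₁ : α₄ ≤ 1 / 84) (hs₂ : L * cstar ≤ 1 / 12) (ha : a ≤ 1 / 4) (ha2 : 2 * a ≤ cstar)
    (hα3 : C0 d * α₀ ≤ 1 / 3) (hα4 : 4 * α₀ ≤ c2' d L)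
    (h16 : 16 * (2 * (L * cstar) + 8 * α₄) ≤ 1) (hd5 : 5 * (2 * (L * cstar) + 8 * α₄) * ((d : ℝ) - 1) ≤ 4)
    (hsmall : Real.exp (4 * (800 * ((d : ℝ) + 1) ^ 2 * ((d : ℝ) + 4)) * α₀)
      * (1 + 8 * (131072 * ((d : ℝ) + 1) ^ 2) * (2 * (L * cstar) + 8 * α₄)) ≤ 2)
    (hc₃ : 2 * (2 * (L * cstar) + 8 * α₄) ≤ c3 d L) (hside : 36 * d * B₀ * (2 * (L * cstar) + 8 * α₄) ≤ 1 / 2)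
    (h50 : 50 * d * (2 * (L * cstar) + 8 * α₄) ≤ 1)
    {C₂ : ℝ} (hC₂ : 8 * (131072 * ((d : ℝ) + 1) ^ 2) * Real.exp (4 * (800 * ((d : ℝ) + 1) ^ 2 * ((d : ℝ) + 4)) * α₀) ≤ C₂)
    (h61 : 2 * (2 * (L * cstar) + 8 * α₄) ^ 2 + 20 * d * α₀ * (2 * (L * cstar) + 8 * α₄)
      + 2 * C₂ * (2 * (L * cstar) + 8 * α₄) ^ 2 ≤ α₀ + α₁)
    (aC : Site d) (M : ℕ) {ρ : ℕ} (hρ : L ≤ ρ) (Λs : ℕ → ℕ → Set (Site d)) (Λb : ℕ → ℕ → Set (Site d × Fin d))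
    (hbox : ∀ m, m ≤ k → ∀ j, j ≤ m → ∀ c ∈ Λb m j, ∀ x, InBox (loK L j c.1) (bondHiK L j c.1 c.2) x → x ∈ (cubeFam false L aC M ρ k) j)
    -- THE PRE-GAUGED FIELD's ROWS IN J3's LETTERS: (1.34)-𝔄 on all of `ℤᵈ` (✓`exists_preGauge_flat` (a)) and the fine near-`1` on `□̃` = the blow-up of the top box `[tLo, tHi]` (its (d) at depth `k`)
    (hInAk : InAk L k η α₀ (fun _ => (Set.univ : Set (Site d))) U')
    (hfine : ∀ (x : Site d) (ν : Fin d), tlo L (tLo aC ρ) k ≤ x → x + e ν ≤ thi L (tHi aC M ρ) k → ‖((U' x ν : 𝔸ˣ) : 𝔸) - 1‖ < a)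
    (hP5base : ∃ (v : Site d → 𝔸ˣ) (lam : Site d → 𝔸), (∀ x, v x ∈ G) ∧
        (∀ j, j ≤ 1 → ∀ b ∈ {b : Site d × Fin d | SideTouches ((cubeFam false L aC M ρ k) j) b.1 b.2}, (v b.1 : 𝔸) = ((gaugeExp lam b.1 : 𝔸ˣ) : 𝔸) ∧
          (v (b.1 + e b.2) : 𝔸) = ((gaugeExp lam (b.1 + e b.2) : 𝔸ˣ) : 𝔸)) ∧
        (∀ j, j ≤ 1 → ∀ b ∈ {b : Site d × Fin d | SideTouches ((cubeFam false L aC M ρ k) j) b.1 b.2},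
          ‖lam b.1‖ ≤ α₄ ∧ ((L : ℝ) ^ j * η) * ‖covDerivFwd η (1 : Site d → Fin d → 𝔸ˣ) b.2 lam b.1‖ ≤ α₄) ∧
        IsLandau138W L 1 η ((cubeFam false L aC M ρ k) 0) (Λs 1) (1 : Site d → Fin d → 𝔸ˣ) (mgauge (1 : Site d → Fin d → 𝔸ˣ) v⁻¹ U') ∧ Restr129 L 1 (Λs 1) (1 : Site d → Fin d → 𝔸ˣ) ((1 : Site d → 𝔸ˣ) * v))
    (hP5 : ∀ m, 1 ≤ m → m < k → ∀ (u₁ : Site d → 𝔸ˣ) (U₁ : Site d → Fin d → 𝔸ˣ) (A : Site d → Fin d → 𝔸),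
      (∀ x, u₁ x ∈ G) → mgauge (1 : Site d → Fin d → 𝔸ˣ) u₁ U₁ = U' → Restr129 L m (Λs m) (1 : Site d → Fin d → 𝔸ˣ) u₁ → IsLandau138W L m η ((cubeFam false L aC M ρ k) 0) (Λs m) (1 : Site d → Fin d → 𝔸ˣ) U₁ →
      (∀ j, j ≤ m → ∀ b ∈ {b : Site d × Fin d | SideTouches ((cubeFam false L aC M ρ k) j) b.1 b.2},
        U₁ b.1 b.2 = cfgExp η A b.1 b.2 ∧ IsSelfAdjoint (A b.1 b.2) ∧ ‖A b.1 b.2‖ ≤ cstar * ((L : ℝ) ^ j * η)⁻¹) →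
      ∃ (v : Site d → 𝔸ˣ) (lam : Site d → 𝔸), (∀ x, v x ∈ G) ∧
        (∀ j, j ≤ m + 1 → ∀ b ∈ {b : Site d × Fin d | SideTouches ((cubeFam false L aC M ρ k) j) b.1 b.2}, (v b.1 : 𝔸) = ((gaugeExp lam b.1 : 𝔸ˣ) : 𝔸) ∧
          (v (b.1 + e b.2) : 𝔸) = ((gaugeExp lam (b.1 + e b.2) : 𝔸ˣ) : 𝔸)) ∧
        (∀ j, j ≤ m + 1 → ∀ b ∈ {b : Site d × Fin d | SideTouches ((cubeFam false L aC M ρ k) j) b.1 b.2},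
          ‖lam b.1‖ ≤ α₄ ∧ ((L : ℝ) ^ j * η) * ‖covDerivFwd η (1 : Site d → Fin d → 𝔸ˣ) b.2 lam b.1‖ ≤ α₄) ∧
        IsLandau138W L (m + 1) η ((cubeFam false L aC M ρ k) 0) (Λs (m + 1)) (1 : Site d → Fin d → 𝔸ˣ) (mgauge (1 : Site d → Fin d → 𝔸ˣ) v⁻¹ U₁) ∧ Restr129 L (m + 1) (Λs (m + 1)) (1 : Site d → Fin d → 𝔸ˣ) (u₁ * v))
    (H42 : ∀ m, 1 ≤ m → m ≤ k → ∀ (u : Site d → 𝔸ˣ) (W : Site d → Fin d → 𝔸ˣ) (A' : Site d → Fin d → 𝔸),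
      (∀ x, u x ∈ unitaryUnits 𝔸) → mgauge (1 : Site d → Fin d → 𝔸ˣ) u W = U' → Restr129 L m (Λs m) (1 : Site d → Fin d → 𝔸ˣ) u → IsLandau138W L m η ((cubeFam false L aC M ρ k) 0) (Λs m) (1 : Site d → Fin d → 𝔸ˣ) W →
      (∀ y τ, IsSelfAdjoint (A' y τ)) →
      (∀ j, j ≤ m → ∀ y τ, SideTouches ((cubeFam false L aC M ρ k) j) y τ →
        W y τ = cfgExp η A' y τ ∧ ‖A' y τ‖ ≤ (2 * (L * cstar) + 8 * α₄) * ((L : ℝ) ^ j * η)⁻¹) →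
      (∀ y τ, (∀ j, j ≤ m → ¬ SideTouches ((cubeFam false L aC M ρ k) j) y τ) → A' y τ = 0) →
      ∀ j, j ≤ m → ∀ c ∈ Λb m j, ‖logCovIter L (1 : Site d → Fin d → 𝔸ˣ) (iEta η A') j c.1 c.2‖ < 2 * d * L * α₁)
    (H59 : ∀ m, 1 ≤ m → m ≤ k → ∀ (u : Site d → 𝔸ˣ) (W : Site d → Fin d → 𝔸ˣ) (A' : Site d → Fin d → 𝔸),
      (∀ x, u x ∈ unitaryUnits 𝔸) → mgauge (1 : Site d → Fin d → 𝔸ˣ) u W = U' → Restr129 L m (Λs m) (1 : Site d → Fin d → 𝔸ˣ) u → IsLandau138W L m η ((cubeFam false L aC M ρ k) 0) (Λs m) (1 : Site d → Fin d → 𝔸ˣ) W →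
      (∀ y τ, IsSelfAdjoint (A' y τ)) →
      (∀ j, j ≤ m → ∀ y τ, SideTouches ((cubeFam false L aC M ρ k) j) y τ →
        W y τ = cfgExp η A' y τ ∧ ‖A' y τ‖ ≤ (2 * (L * cstar) + 8 * α₄) * ((L : ℝ) ^ j * η)⁻¹) →
      (∀ y τ, (∀ j, j ≤ m → ¬ SideTouches ((cubeFam false L aC M ρ k) j) y τ) → A' y τ = 0) →
      msup L m η (-(1 : ℝ)) (fun j (b : Site d × Fin d) => SideTouches ((cubeFam false L aC M ρ k) j) b.1 b.2) (fun b => A' b.1 b.2)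
          ≤ B₀ * (bondNorm L m η (-(3 : ℝ)) (cubeFam false L aC M ρ k) (fun x μ => Jcur η (1 : Site d → Fin d → 𝔸ˣ) A' μ x)
            + wsup 1 (fun p : {p : ℕ × (Site d × Fin d) // p.1 ≤ m ∧ p.2 ∈ Λb m p.1} =>
                linCovIter L (1 : Site d → Fin d → 𝔸ˣ) (iEta η A') p.1.1 p.1.2.1 p.1.2.2)) ∧
        msup L m η (-(2 : ℝ)) (fun j (t : Fin d × Fin d × Site d) => SideTouches ((cubeFam false L aC M ρ k) j) t.2.2 t.2.1)
            (fun t => covDerivFwd η (1 : Site d → Fin d → 𝔸ˣ) t.1 (fun z => A' z t.2.1) t.2.2)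
          ≤ B₀ * (bondNorm L m η (-(3 : ℝ)) (cubeFam false L aC M ρ k) (fun x μ => Jcur η (1 : Site d → Fin d → 𝔸ˣ) A' μ x)
            + wsup 1 (fun p : {p : ℕ × (Site d × Fin d) // p.1 ≤ m ∧ p.2 ∈ Λb m p.1} =>
                linCovIter L (1 : Site d → Fin d → 𝔸ˣ) (iEta η A') p.1.1 p.1.2.1 p.1.2.2))) :
    ∀ m, m ≤ k → ∃ u : Site d → 𝔸ˣ, (∀ x, u x ∈ G) ∧ Restr129 L m (Λs m) (1 : Site d → Fin d → 𝔸ˣ) u ∧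
      ∃ W : Site d → Fin d → 𝔸ˣ, mgauge (1 : Site d → Fin d → 𝔸ˣ) u W = U' ∧ (1 ≤ m → IsLandau138W L m η ((cubeFam false L aC M ρ k) 0) (Λs m) (1 : Site d → Fin d → 𝔸ˣ) W) ∧
        ∃ A : Site d → Fin d → 𝔸, ∀ j, j ≤ m → ∀ b ∈ {b : Site d × Fin d | SideTouches ((cubeFam false L aC M ρ k) j) b.1 b.2},
          W b.1 b.2 = cfgExp η A b.1 b.2 ∧ IsSelfAdjoint (A b.1 b.2) ∧ ‖A b.1 b.2‖ ≤ cstar * ((L : ℝ) ^ j * η)⁻¹ := by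
  have hL1 : 1 ≤ L := le_trans (by norm_num) hL
  have hρ1 : 1 ≤ ρ := le_trans hL1 hρ
  refine datum_of_preGauge_mem hd2 hη hL k G hG hU' hα₀ hα₁ hα₄ hB₀ hc hs₁ hs₂ ha ha2 hα3 hα4 h16 hd5 hsmall hc₃ hside h50 hC₂ h61
    (cubeFam false L aC M ρ k) (hΩ_cubeFam hL1 aC M hρ k) Λs Λb hbox hInAk (fun y τ hyτ => ?_) hfine hP5base hP5 H42 H59
  rw [cubeFam_false_of_le L aC M ρ (Nat.zero_le k)] at hyτ
  exact ends_of_sideTouches (collar_cube hL hρ1 (Nat.zero_le k)) hyτ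

end Main

/-! ## §2 The τ-datum letter of the per-site assembly -/

/-- At `𝔸 := M₂(ℂ)`, `G := specialUnitaryUnits (Fin 2)`: `u₁ x ∈ G` IS ✓p647313's `hu₁SU` letter `↑(u₁ z) ∈ Matrix.specialUnitaryGroup (Fin 2) ℂ` (membership unfolds by `Iff.rfl`).
[cite: Balaban1985RegularSpaces, p.76 («G = SU(N)»)] -/
theorem hu₁SU_of_mem {u₁ : Site d → (Matrix (Fin 2) (Fin 2) ℂ)ˣ} (h : ∀ x, u₁ x ∈ B7Prop2SpecialUnitary.specialUnitaryUnits (Fin 2)) :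
    ∀ z, ((u₁ z : (Matrix (Fin 2) (Fin 2) ℂ)ˣ) : Matrix (Fin 2) (Fin 2) ℂ) ∈ Matrix.specialUnitaryGroup (Fin 2) ℂ :=
  fun z => B7Prop2SpecialUnitary.mem_specialUnitaryUnits.1 (h z)

/-! ## §3 The `SU(2)` edition at the member (the letter of ✓p647313 ∕ ✓p650940 ∕ the ρ3 outer knit) -/

section SU

open scoped Matrix.Norms.L2Operator
open B7Prop2SpecialUnitary (specialUnitaryUnits specialUnitaryUnits_le_unitaryUnits)

/-- ★★★ **THE JUNCTION CALL AT THE CUBE MEMBER, `SU(2)` EDITION** — `datum_of_preGauge_cubeMember_mem` at `𝔸 := M₂(ℂ)`, `G := specialUnitaryUnits (Fin 2)` (`hG` by lit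
✓`specialUnitaryUnits_le_unitaryUnits`): Theorem 4's datum `(u₁, W, A)` at every level `m ≤ k` for J3's pre-gauged field WITH `hu₁SU : ∀ z, ↑(u₁ z) ∈ SU(2)` — the [τ-DATUM]
row of «H = hSupUρ2∕ρ3 ⟸ hSiteRows» — from the `SU(2)`-form Proposition-5 sockets (inhabited by their τ-bodies) and `H42`∕`H59`.
[cite: Balaban1985RegularSpaces, Thm 4 p.88, Prop. 5 p.94, p.76 («G = SU(N)»), p.98, (1.66) p.87] -/
theorem datum_of_preGauge_cubeMember_SU (hd2 : 2 ≤ d) {η : ℝ} (hη : 0 < η) {L : ℕ} (hL : 2 ≤ L) (k : ℕ)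
    {U' : Site d → Fin d → (Matrix (Fin 2) (Fin 2) ℂ)ˣ} (hU' : ∀ x κ, U' x κ ∈ unitaryUnits (Matrix (Fin 2) (Fin 2) ℂ))
    {α₀ α₁ α₄ B₀ cstar a : ℝ} (hα₀ : 0 < α₀) (hα₁ : 0 ≤ α₁) (hα₄ : 0 ≤ α₄) (hB₀ : 0 ≤ B₀)
    (hc : cstar = 5 * d * L * B₀ * (α₀ + α₁))
    (hs₁ : α₄ ≤ 1 / 84) (hs₂ : L * cstar ≤ 1 / 12) (ha : a ≤ 1 / 4) (ha2 : 2 * a ≤ cstar)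
    (hα3 : C0 d * α₀ ≤ 1 / 3) (hα4 : 4 * α₀ ≤ c2' d L)
    (h16 : 16 * (2 * (L * cstar) + 8 * α₄) ≤ 1) (hd5 : 5 * (2 * (L * cstar) + 8 * α₄) * ((d : ℝ) - 1) ≤ 4)
    (hsmall : Real.exp (4 * (800 * ((d : ℝ) + 1) ^ 2 * ((d : ℝ) + 4)) * α₀)
      * (1 + 8 * (131072 * ((d : ℝ) + 1) ^ 2) * (2 * (L * cstar) + 8 * α₄)) ≤ 2)
    (hc₃ : 2 * (2 * (L * cstar) + 8 * α₄) ≤ c3 d L) (hside : 36 * d * B₀ * (2 * (L * cstar) + 8 * α₄) ≤ 1 / 2)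
    (h50 : 50 * d * (2 * (L * cstar) + 8 * α₄) ≤ 1)
    {C₂ : ℝ} (hC₂ : 8 * (131072 * ((d : ℝ) + 1) ^ 2) * Real.exp (4 * (800 * ((d : ℝ) + 1) ^ 2 * ((d : ℝ) + 4)) * α₀) ≤ C₂)
    (h61 : 2 * (2 * (L * cstar) + 8 * α₄) ^ 2 + 20 * d * α₀ * (2 * (L * cstar) + 8 * α₄)
      + 2 * C₂ * (2 * (L * cstar) + 8 * α₄) ^ 2 ≤ α₀ + α₁)
    (aC : Site d) (M : ℕ) {ρ : ℕ} (hρ : L ≤ ρ) (Λs : ℕ → ℕ → Set (Site d)) (Λb : ℕ → ℕ → Set (Site d × Fin d))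
    (hbox : ∀ m, m ≤ k → ∀ j, j ≤ m → ∀ c ∈ Λb m j, ∀ x, InBox (loK L j c.1) (bondHiK L j c.1 c.2) x → x ∈ (cubeFam false L aC M ρ k) j)
    -- THE PRE-GAUGED FIELD's ROWS IN J3's LETTERS: (1.34)-𝔄 on all of `ℤᵈ` (✓`exists_preGauge_flat` (a)) and the fine near-`1` on `□̃` = the blow-up of the top box `[tLo, tHi]` (its (d) at depth `k`)
    (hInAk : InAk L k η α₀ (fun _ => (Set.univ : Set (Site d))) U')
    (hfine : ∀ (x : Site d) (ν : Fin d), tlo L (tLo aC ρ) k ≤ x → x + e ν ≤ thi L (tHi aC M ρ) k → ‖((U' x ν : (Matrix (Fin 2) (Fin 2) ℂ)ˣ) : (Matrix (Fin 2) (Fin 2) ℂ)) - 1‖ < a)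
    (hP5base : ∃ (v : Site d → (Matrix (Fin 2) (Fin 2) ℂ)ˣ) (lam : Site d → (Matrix (Fin 2) (Fin 2) ℂ)), (∀ x, v x ∈ specialUnitaryUnits (Fin 2)) ∧
        (∀ j, j ≤ 1 → ∀ b ∈ {b : Site d × Fin d | SideTouches ((cubeFam false L aC M ρ k) j) b.1 b.2}, (v b.1 : (Matrix (Fin 2) (Fin 2) ℂ)) = ((gaugeExp lam b.1 : (Matrix (Fin 2) (Fin 2) ℂ)ˣ) : (Matrix (Fin 2) (Fin 2) ℂ)) ∧
          (v (b.1 + e b.2) : (Matrix (Fin 2) (Fin 2) ℂ)) = ((gaugeExp lam (b.1 + e b.2) : (Matrix (Fin 2) (Fin 2) ℂ)ˣ) : (Matrix (Fin 2) (Fin 2) ℂ))) ∧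
        (∀ j, j ≤ 1 → ∀ b ∈ {b : Site d × Fin d | SideTouches ((cubeFam false L aC M ρ k) j) b.1 b.2},
          ‖lam b.1‖ ≤ α₄ ∧ ((L : ℝ) ^ j * η) * ‖covDerivFwd η (1 : Site d → Fin d → (Matrix (Fin 2) (Fin 2) ℂ)ˣ) b.2 lam b.1‖ ≤ α₄) ∧
        IsLandau138W L 1 η ((cubeFam false L aC M ρ k) 0) (Λs 1) (1 : Site d → Fin d → (Matrix (Fin 2) (Fin 2) ℂ)ˣ) (mgauge (1 : Site d → Fin d → (Matrix (Fin 2) (Fin 2) ℂ)ˣ) v⁻¹ U') ∧ Restr129 L 1 (Λs 1) (1 : Site d → Fin d → (Matrix (Fin 2) (Fin 2) ℂ)ˣ) ((1 : Site d → (Matrix (Fin 2) (Fin 2) ℂ)ˣ) * v))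
    (hP5 : ∀ m, 1 ≤ m → m < k → ∀ (u₁ : Site d → (Matrix (Fin 2) (Fin 2) ℂ)ˣ) (U₁ : Site d → Fin d → (Matrix (Fin 2) (Fin 2) ℂ)ˣ) (A : Site d → Fin d → (Matrix (Fin 2) (Fin 2) ℂ)),
      (∀ x, u₁ x ∈ specialUnitaryUnits (Fin 2)) → mgauge (1 : Site d → Fin d → (Matrix (Fin 2) (Fin 2) ℂ)ˣ) u₁ U₁ = U' → Restr129 L m (Λs m) (1 : Site d → Fin d → (Matrix (Fin 2) (Fin 2) ℂ)ˣ) u₁ → IsLandau138W L m η ((cubeFam false L aC M ρ k) 0) (Λs m) (1 : Site d → Fin d → (Matrix (Fin 2) (Fin 2) ℂ)ˣ) U₁ →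
      (∀ j, j ≤ m → ∀ b ∈ {b : Site d × Fin d | SideTouches ((cubeFam false L aC M ρ k) j) b.1 b.2},
        U₁ b.1 b.2 = cfgExp η A b.1 b.2 ∧ IsSelfAdjoint (A b.1 b.2) ∧ ‖A b.1 b.2‖ ≤ cstar * ((L : ℝ) ^ j * η)⁻¹) →
      ∃ (v : Site d → (Matrix (Fin 2) (Fin 2) ℂ)ˣ) (lam : Site d → (Matrix (Fin 2) (Fin 2) ℂ)), (∀ x, v x ∈ specialUnitaryUnits (Fin 2)) ∧
        (∀ j, j ≤ m + 1 → ∀ b ∈ {b : Site d × Fin d | SideTouches ((cubeFam false L aC M ρ k) j) b.1 b.2}, (v b.1 : (Matrix (Fin 2) (Fin 2) ℂ)) = ((gaugeExp lam b.1 : (Matrix (Fin 2) (Fin 2) ℂ)ˣ) : (Matrix (Fin 2) (Fin 2) ℂ)) ∧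
          (v (b.1 + e b.2) : (Matrix (Fin 2) (Fin 2) ℂ)) = ((gaugeExp lam (b.1 + e b.2) : (Matrix (Fin 2) (Fin 2) ℂ)ˣ) : (Matrix (Fin 2) (Fin 2) ℂ))) ∧
        (∀ j, j ≤ m + 1 → ∀ b ∈ {b : Site d × Fin d | SideTouches ((cubeFam false L aC M ρ k) j) b.1 b.2},
          ‖lam b.1‖ ≤ α₄ ∧ ((L : ℝ) ^ j * η) * ‖covDerivFwd η (1 : Site d → Fin d → (Matrix (Fin 2) (Fin 2) ℂ)ˣ) b.2 lam b.1‖ ≤ α₄) ∧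
        IsLandau138W L (m + 1) η ((cubeFam false L aC M ρ k) 0) (Λs (m + 1)) (1 : Site d → Fin d → (Matrix (Fin 2) (Fin 2) ℂ)ˣ) (mgauge (1 : Site d → Fin d → (Matrix (Fin 2) (Fin 2) ℂ)ˣ) v⁻¹ U₁) ∧ Restr129 L (m + 1) (Λs (m + 1)) (1 : Site d → Fin d → (Matrix (Fin 2) (Fin 2) ℂ)ˣ) (u₁ * v))
    (H42 : ∀ m, 1 ≤ m → m ≤ k → ∀ (u : Site d → (Matrix (Fin 2) (Fin 2) ℂ)ˣ) (W : Site d → Fin d → (Matrix (Fin 2) (Fin 2) ℂ)ˣ) (A' : Site d → Fin d → (Matrix (Fin 2) (Fin 2) ℂ)),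
      (∀ x, u x ∈ unitaryUnits (Matrix (Fin 2) (Fin 2) ℂ)) → mgauge (1 : Site d → Fin d → (Matrix (Fin 2) (Fin 2) ℂ)ˣ) u W = U' → Restr129 L m (Λs m) (1 : Site d → Fin d → (Matrix (Fin 2) (Fin 2) ℂ)ˣ) u → IsLandau138W L m η ((cubeFam false L aC M ρ k) 0) (Λs m) (1 : Site d → Fin d → (Matrix (Fin 2) (Fin 2) ℂ)ˣ) W →
      (∀ y τ, IsSelfAdjoint (A' y τ)) →
      (∀ j, j ≤ m → ∀ y τ, SideTouches ((cubeFam false L aC M ρ k) j) y τ →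
        W y τ = cfgExp η A' y τ ∧ ‖A' y τ‖ ≤ (2 * (L * cstar) + 8 * α₄) * ((L : ℝ) ^ j * η)⁻¹) →
      (∀ y τ, (∀ j, j ≤ m → ¬ SideTouches ((cubeFam false L aC M ρ k) j) y τ) → A' y τ = 0) →
      ∀ j, j ≤ m → ∀ c ∈ Λb m j, ‖logCovIter L (1 : Site d → Fin d → (Matrix (Fin 2) (Fin 2) ℂ)ˣ) (iEta η A') j c.1 c.2‖ < 2 * d * L * α₁)
    (H59 : ∀ m, 1 ≤ m → m ≤ k → ∀ (u : Site d → (Matrix (Fin 2) (Fin 2) ℂ)ˣ) (W : Site d → Fin d → (Matrix (Fin 2) (Fin 2) ℂ)ˣ) (A' : Site d → Fin d → (Matrix (Fin 2) (Fin 2) ℂ)),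
      (∀ x, u x ∈ unitaryUnits (Matrix (Fin 2) (Fin 2) ℂ)) → mgauge (1 : Site d → Fin d → (Matrix (Fin 2) (Fin 2) ℂ)ˣ) u W = U' → Restr129 L m (Λs m) (1 : Site d → Fin d → (Matrix (Fin 2) (Fin 2) ℂ)ˣ) u → IsLandau138W L m η ((cubeFam false L aC M ρ k) 0) (Λs m) (1 : Site d → Fin d → (Matrix (Fin 2) (Fin 2) ℂ)ˣ) W →
      (∀ y τ, IsSelfAdjoint (A' y τ)) →
      (∀ j, j ≤ m → ∀ y τ, SideTouches ((cubeFam false L aC M ρ k) j) y τ →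
        W y τ = cfgExp η A' y τ ∧ ‖A' y τ‖ ≤ (2 * (L * cstar) + 8 * α₄) * ((L : ℝ) ^ j * η)⁻¹) →
      (∀ y τ, (∀ j, j ≤ m → ¬ SideTouches ((cubeFam false L aC M ρ k) j) y τ) → A' y τ = 0) →
      msup L m η (-(1 : ℝ)) (fun j (b : Site d × Fin d) => SideTouches ((cubeFam false L aC M ρ k) j) b.1 b.2) (fun b => A' b.1 b.2)
          ≤ B₀ * (bondNorm L m η (-(3 : ℝ)) (cubeFam false L aC M ρ k) (fun x μ => Jcur η (1 : Site d → Fin d → (Matrix (Fin 2) (Fin 2) ℂ)ˣ) A' μ x)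
            + wsup 1 (fun p : {p : ℕ × (Site d × Fin d) // p.1 ≤ m ∧ p.2 ∈ Λb m p.1} =>
                linCovIter L (1 : Site d → Fin d → (Matrix (Fin 2) (Fin 2) ℂ)ˣ) (iEta η A') p.1.1 p.1.2.1 p.1.2.2)) ∧
        msup L m η (-(2 : ℝ)) (fun j (t : Fin d × Fin d × Site d) => SideTouches ((cubeFam false L aC M ρ k) j) t.2.2 t.2.1)
            (fun t => covDerivFwd η (1 : Site d → Fin d → (Matrix (Fin 2) (Fin 2) ℂ)ˣ) t.1 (fun z => A' z t.2.1) t.2.2)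
          ≤ B₀ * (bondNorm L m η (-(3 : ℝ)) (cubeFam false L aC M ρ k) (fun x μ => Jcur η (1 : Site d → Fin d → (Matrix (Fin 2) (Fin 2) ℂ)ˣ) A' μ x)
            + wsup 1 (fun p : {p : ℕ × (Site d × Fin d) // p.1 ≤ m ∧ p.2 ∈ Λb m p.1} =>
                linCovIter L (1 : Site d → Fin d → (Matrix (Fin 2) (Fin 2) ℂ)ˣ) (iEta η A') p.1.1 p.1.2.1 p.1.2.2))) :
    ∀ m, m ≤ k → ∃ u : Site d → (Matrix (Fin 2) (Fin 2) ℂ)ˣ, (∀ x, ((u x : (Matrix (Fin 2) (Fin 2) ℂ)ˣ) : Matrix (Fin 2) (Fin 2) ℂ) ∈ Matrix.specialUnitaryGroup (Fin 2) ℂ) ∧ Restr129 L m (Λs m) (1 : Site d → Fin d → (Matrix (Fin 2) (Fin 2) ℂ)ˣ) u ∧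
      ∃ W : Site d → Fin d → (Matrix (Fin 2) (Fin 2) ℂ)ˣ, mgauge (1 : Site d → Fin d → (Matrix (Fin 2) (Fin 2) ℂ)ˣ) u W = U' ∧ (1 ≤ m → IsLandau138W L m η ((cubeFam false L aC M ρ k) 0) (Λs m) (1 : Site d → Fin d → (Matrix (Fin 2) (Fin 2) ℂ)ˣ) W) ∧
        ∃ A : Site d → Fin d → (Matrix (Fin 2) (Fin 2) ℂ), ∀ j, j ≤ m → ∀ b ∈ {b : Site d × Fin d | SideTouches ((cubeFam false L aC M ρ k) j) b.1 b.2},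
          W b.1 b.2 = cfgExp η A b.1 b.2 ∧ IsSelfAdjoint (A b.1 b.2) ∧ ‖A b.1 b.2‖ ≤ cstar * ((L : ℝ) ^ j * η)⁻¹ := by
  letI : CStarAlgebra (Matrix (Fin 2) (Fin 2) ℂ) := B10Eq29TubeLine.cstarAlgebraMatrix 2
  intro m hm
  obtain ⟨u, hu, h129, W, hW, hLan, A, hA⟩ := datum_of_preGauge_cubeMember_mem hd2 hη hL k (specialUnitaryUnits (Fin 2))
    specialUnitaryUnits_le_unitaryUnits hU' hα₀ hα₁ hα₄ hB₀ hc hs₁ hs₂ ha ha2 hα3 hα4 h16 hd5 hsmall hc₃ hside h50 hC₂ h61 aC M hρ Λs Λb hbox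
    hInAk hfine hP5base hP5 H42 H59 m hm
  exact ⟨u, hu₁SU_of_mem hu, h129, W, hW, hLan, A, hA⟩

end SU

end Summit.QuantumFields.YangMills.Theorems.HalvingP1FlatCoreSupplierInductionSU

end
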